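import Summits.Ventures.PercRepro.BinomialLayerN

/-!
# PercRepro — (N2) the `D(ℓ)` lemma of mine-2's Theorem N (typer-2, gen 6)

`proofs/MINE2-RLS.md` §14, (N2): for every `p ≥ 4` and `ℓ ≥ 4`,
`Σ_{b=2}^{ℓ} C(ℓ, b)·F(p, b) ≥ Φ(p, 2)·(2^ℓ − ℓ − 2)`,
from the three inequalities of (N1) and the monotonicity of `F(p, ·)`:

* **`F_mono`** — `F(p, b) ≤ F(p, b + 1)` (termwise: `C(b,2)/C(b+x,2)` increases in `b`), hence **`F_four_le`**;
* **`sum_Icc_four_choose`** — `Σ_{b=4}^{ℓ} C(ℓ, b) = 2^ℓ − 1 − ℓ − C(ℓ,2) − C(ℓ,3)`;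
* **`D_lemma`** — the three cases: `ℓ = 4` is (d) itself; `ℓ = 5` is (a) + (c) + (d); `ℓ ≥ 6` uses (c) and
  `F(p, 4) ≥ Φ` once `Σ_{b≥4} C(ℓ,b) ≥ (5/4)·C(ℓ,2)` (`four_mul_le`, true from `ℓ = 6` on).
-/

namespace PercRepro

open Finset

namespace BinomialLayer

/-- `C(b,2)/C(b+x,2)` is nondecreasing in `b` (for `x ≥ 0`, `b ≥ 2`). -/
theorem choose_ratio_mono (b x : ℕ) (hb : 2 ≤ b) :
    (b.choose 2 : ℚ) / ((b + x).choose 2 : ℚ) ≤ ((b + 1).choose 2 : ℚ) / ((b + 1 + x).choose 2 : ℚ) := by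
  rw [Nat.cast_choose_two, Nat.cast_choose_two, Nat.cast_choose_two, Nat.cast_choose_two]
  push_cast
  have hb' : (2 : ℚ) ≤ b := by exact_mod_cast hb
  have hx : (0 : ℚ) ≤ x := by positivity
  have d1 : (0 : ℚ) < (b + x) * (b + x - 1) / 2 := by nlinarith
  have d2 : (0 : ℚ) < (b + 1 + x) * (b + 1 + x - 1) / 2 := by nlinarith
  rw [div_le_div_iff₀ d1 d2]
  have hb0 : (0 : ℚ) ≤ b := by positivity
  have hbx : (0 : ℚ) ≤ b + x := by positivity
  nlinarith [mul_nonneg (mul_nonneg hb0 hbx) hx]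

/-- **`F(p, ·)` is nondecreasing** from `b = 2` on. -/
theorem F_mono (p b : ℕ) (hb : 2 ≤ b) : F p b ≤ F p (b + 1) := by
  unfold F
  refine Finset.sum_le_sum fun x _ => ?_
  have hc : (0 : ℚ) ≤ ((p - 1).choose x : ℚ) := by positivity
  rw [mul_div_assoc, mul_div_assoc]
  exact mul_le_mul_of_nonneg_left (choose_ratio_mono b x hb) hc

/-- `F(p, 4) ≤ F(p, b)` for `b ≥ 4`. -/
theorem F_four_le (p : ℕ) : ∀ b, 4 ≤ b → F p 4 ≤ F p b := by
  intro b hb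
  induction b with
  | zero => omega
  | succ b ih =>
    rcases Nat.lt_or_ge b 4 with h | h
    · have : b = 3 := by omega
      subst this
      exact le_rfl
    · exact (ih h).trans (F_mono p b (by omega))

/-- `Σ_{b=4}^{ℓ} C(ℓ, b) = 2^ℓ − 1 − ℓ − C(ℓ,2) − C(ℓ,3)` for `ℓ ≥ 3`, in `ℚ`. -/
theorem sum_Icc_four_choose (ℓ : ℕ) (hℓ : 3 ≤ ℓ) :
    (∑ b ∈ Icc 4 ℓ, (ℓ.choose b : ℚ)) = 2 ^ ℓ - 1 - ℓ - (ℓ.choose 2 : ℚ) - (ℓ.choose 3 : ℚ) := by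
  have hfull : (∑ b ∈ range (ℓ + 1), (ℓ.choose b : ℚ)) = 2 ^ ℓ := by
    exact_mod_cast Nat.sum_range_choose ℓ
  have hIcc : Icc 4 ℓ = Ico 4 (ℓ + 1) := rfl
  have hcons := Finset.sum_Ico_consecutive (fun b => (ℓ.choose b : ℚ)) (by omega : 0 ≤ 4)
    (by omega : 4 ≤ ℓ + 1)
  rw [← Finset.range_eq_Ico, ← Finset.range_eq_Ico] at hcons
  have h4 : (∑ b ∈ range 4, (ℓ.choose b : ℚ)) = 1 + ℓ + (ℓ.choose 2 : ℚ) + (ℓ.choose 3 : ℚ) := by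
    simp [Finset.sum_range_succ]
  rw [hIcc]
  linarith [hcons, h4, hfull]

/-- `C(n, 3) = n(n−1)(n−2)/6` in `ℚ`. -/
theorem cast_choose_three (n : ℕ) (hn : 2 ≤ n) :
    (n.choose 3 : ℚ) = n * (n - 1) * (n - 2) / 6 := by
  have h := Nat.choose_succ_right_eq n 2
  have h' : ((n.choose 3 : ℕ) : ℚ) * 3 = (n.choose 2 : ℚ) * ((n - 2 : ℕ) : ℚ) := by exact_mod_cast h
  rw [Nat.cast_sub hn, Nat.cast_choose_two] at h'
  push_cast at h'
  linear_combination h' / 3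

/-- `4·(2^ℓ − 1 − ℓ − C(ℓ,2) − C(ℓ,3)) ≥ 5·C(ℓ,2)` for `ℓ ≥ 6`. -/
theorem four_mul_le (ℓ : ℕ) (hℓ : 6 ≤ ℓ) :
    5 * (ℓ.choose 2 : ℚ) ≤ 4 * (2 ^ ℓ - 1 - ℓ - (ℓ.choose 2 : ℚ) - (ℓ.choose 3 : ℚ)) := by
  obtain ⟨m, rfl⟩ : ∃ m, ℓ = m + 6 := ⟨ℓ - 6, by omega⟩
  -- `4·2^ℓ ≥ 4 + 4ℓ + 9·C(ℓ,2) + 4·C(ℓ,3)` for `ℓ ≥ 6`, by induction (the right side less than doubles)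
  have key : ∀ m : ℕ, (4 + 4 * (m + 6 : ℚ) + 9 * ((m + 6) * (m + 5) / 2) +
      4 * ((m + 6) * (m + 5) * (m + 4) / 6) : ℚ) ≤ 4 * 2 ^ (m + 6) := by
    intro m
    induction m with
    | zero => norm_num
    | succ m ih =>
      have hm : (0 : ℚ) ≤ m := by positivity
      rw [pow_succ]
      push_cast
      nlinarith [ih, mul_nonneg hm hm, mul_nonneg (mul_nonneg hm hm) hm]
  have hk := key m
  rw [Nat.cast_choose_two, cast_choose_three _ (by omega)]
  push_cast
  nlinarith [hk]

/-- **The `D(ℓ)` lemma** (mine-2 §14 (N2)): for `p ≥ 4` and `ℓ ≥ 4`,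
`Φ(p, 2)·(2^ℓ − ℓ − 2) ≤ Σ_{b=2}^{ℓ} C(ℓ, b)·F(p, b)`. -/
theorem D_lemma (p ℓ : ℕ) (hp : 4 ≤ p) (hℓ : 4 ≤ ℓ) :
    phiTwo p * (2 ^ ℓ - ℓ - 2 : ℚ) ≤ ∑ b ∈ Icc 2 ℓ, (ℓ.choose b : ℚ) * F p b := by
  have ha := phiTwo_le_F_three p hp
  have hc := nine_phiTwo_le p hp
  have hd := ten_phiTwo_le p hp
  have h34 := F_mono p 3 (by norm_num)
  have hΦ : 0 ≤ phiTwo p := by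
    unfold phiTwo
    positivity
  -- split the sum: `b = 2`, `b = 3`, `b ≥ 4`
  have hsplit : (∑ b ∈ Icc 2 ℓ, (ℓ.choose b : ℚ) * F p b) =
      (ℓ.choose 2 : ℚ) * F p 2 + (ℓ.choose 3 : ℚ) * F p 3 + ∑ b ∈ Icc 4 ℓ, (ℓ.choose b : ℚ) * F p b := by
    have h1 : Icc 2 ℓ = Ico 2 (ℓ + 1) := rfl
    have h2 : Icc 4 ℓ = Ico 4 (ℓ + 1) := rfl
    rw [h1, h2, ← Finset.sum_Ico_consecutive _ (by omega : 2 ≤ 4) (by omega : 4 ≤ ℓ + 1),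
      Finset.sum_Ico_succ_top (by omega : 2 ≤ 3), Finset.sum_Ico_succ_top (by omega : 2 ≤ 2),
      Finset.Ico_self, Finset.sum_empty]
    ring
  -- the tail is at least `(Σ_{b ≥ 4} C(ℓ,b))·F(p, 4)`
  have htail : (∑ b ∈ Icc 4 ℓ, (ℓ.choose b : ℚ)) * F p 4 ≤ ∑ b ∈ Icc 4 ℓ, (ℓ.choose b : ℚ) * F p b := by
    rw [Finset.sum_mul]
    refine Finset.sum_le_sum fun b hb => ?_
    rw [Finset.mem_Icc] at hb
    exact mul_le_mul_of_nonneg_left (F_four_le p b hb.1) (by positivity)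
  rw [sum_Icc_four_choose ℓ (by omega)] at htail
  rw [hsplit]
  set A : ℚ := 2 ^ ℓ - 1 - ℓ - (ℓ.choose 2 : ℚ) - (ℓ.choose 3 : ℚ) with hA
  have h2ℓ : (2 : ℚ) ^ ℓ - ℓ - 2 = (ℓ.choose 2 : ℚ) + (ℓ.choose 3 : ℚ) + A - 1 := by
    rw [hA]; ring
  rw [h2ℓ]
  rcases Nat.lt_or_ge ℓ 6 with hsmall | hbig
  · interval_cases ℓ
    · -- `ℓ = 4`: `A = 1`, exactly (d)
      have c42 : Nat.choose 4 2 = 6 := by decide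
      have c43 : Nat.choose 4 3 = 4 := by decide
      have hA4 : A = 1 := by rw [hA]; simp only [c42, c43]; norm_num
      have hI : Icc 4 4 = {4} := by decide
      rw [hI, Finset.sum_singleton, Nat.choose_self] at htail ⊢
      rw [hA4] at htail ⊢
      simp only [c42, c43] at ⊢
      push_cast at htail ⊢
      nlinarith [hd, htail]
    · -- `ℓ = 5`: `A = 6`; (a) + (c) + (d) with `F(p,5) ≥ F(p,4)`
      have c52 : Nat.choose 5 2 = 10 := by decide
      have c53 : Nat.choose 5 3 = 10 := by decide
      have c54 : Nat.choose 5 4 = 5 := by decide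
      have hA5 : A = 6 := by rw [hA]; simp only [c52, c53]; norm_num
      have hI : Icc 4 5 = {4, 5} := by decide
      rw [hI, Finset.sum_pair (by norm_num), Nat.choose_self, c54] at htail ⊢
      rw [hA5] at htail ⊢
      simp only [c52, c53] at ⊢
      push_cast at htail ⊢
      nlinarith [ha, hc, hd, htail]
  · -- `ℓ ≥ 6`: (c) and `F(p,4) ≥ Φ`, with `A ≥ (5/4)·C(ℓ,2)`
    have hAle := four_mul_le ℓ hbig
    rw [← hA] at hAle
    have hF4 : phiTwo p ≤ F p 4 := ha.trans h34
    have hc2 : (0 : ℚ) ≤ (ℓ.choose 2 : ℚ) := by positivity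
    have hc3 : (0 : ℚ) ≤ (ℓ.choose 3 : ℚ) := by positivity
    nlinarith [hc, ha, hF4, htail, hAle, hΦ, hc2, hc3, mul_nonneg hc3 (sub_nonneg.mpr ha),
      mul_nonneg (sub_nonneg.mpr hAle) (sub_nonneg.mpr hF4), mul_nonneg hc2 (sub_nonneg.mpr hF4)]

end BinomialLayer

end PercRepro
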